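import Mathlib
import HarnessLib
import Summits.QuantumFields.YangMills.Theses.PencilRigidity
import Summits.QuantumFields.YangMills.Theorems.HypercubicLimit.Negative.OneFieldReduction
import Summits.QuantumFields.YangMills.Theorems.HypercubicLimit.Negative.NonabelianLoadBearing
import Literature.MathematicalPhysics.QuantumFieldTheory.YangMillsOS
import Literature.MathematicalPhysics.QuantumLattice.LatticeGaugeDLR

/-!
# drefute gen 2 — reshape-2 stub set of line `conditional-mean-telescoping` (crux `HypercubicLimit`,
stmt-QuantumFields-8646): verbatim mirror of the skeleton's objects and stub `Prop`s
(`Cruxes/HypercubicLimit/Lines/conditional-mean-telescoping.lean`, registry sha 66f5c10f…, base site `x`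
carried by `influence`; new `CondMeanLocality`), namespace changed only, plus the refuter's checks.
-/

noncomputable section

open scoped SchwartzMap ENNReal
open MeasureTheory Filter Topology
open Literature.MathematicalPhysics.AQFT Literature.MathematicalPhysics.QuantumLattice
open Literature.MathematicalPhysics.QuantumFieldTheory

namespace Summit.QuantumFields.YangMills.Cruxes.HypercubicLimit.DRefute2

local notation "E4" => EuclideanSpace ℝ (Fin 4)
local notation "Zd4" => Literature.Probability.LatticeModels.Site 4
local notation "ZdEdge4" => Literature.MathematicalPhysics.QuantumLattice.ZdEdge 4
/-! ## 0. Objects: one plaquette, its cube-exterior influence, its RP square -/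

section Objects

variable {G : Type} [Group G] [TopologicalSpace G] [IsTopologicalGroup G] [CompactSpace G]
  [MeasurableSpace G] [BorelSpace G]

/-- Edges of `ℤ⁴` interior to the `ℓ^∞`-cube of radius `R` about `x` (both endpoints inside). -/
def cubeEdges (R : ℕ) (x : Zd4) : Set ZdEdge4 :=
  {e | (∀ μ, |e.1 μ - x μ| ≤ R) ∧ ∀ μ, |e.1 μ + (if μ = e.2 then 1 else 0) - x μ| ≤ R}

/-- Their images on the torus of side `L` (the cube must fit: `2R + 2 ≤ L`). -/
def cubeEdgesT (L R : ℕ) (x : Zd4) : Set (Edge 4 L) :=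
  torusEdge L '' cubeEdges R x

/-- The **exterior σ-algebra** of the cube `Q_R(x)`: cylinder events of the torus links NOT
interior to the cube (Mathlib `cylinderEvents`). -/
@[reducible] def exterior (L R : ℕ) (x : Zd4) : MeasurableSpace (GaugeConfig 4 L G) :=
  cylinderEvents (X := fun _ : Edge 4 L => G) (cubeEdgesT L R x)ᶜ

/-- The single plaquette observable `Re tr ρ(U_p)` of orientation `(i, j)` based at the
`ℤ⁴`-site `x`, on the torus of side `L` (periodic lift). -/
def torusPlaquette (r : LatticeRep G) (L : ℕ) (i j : Fin 4) (x : Zd4) (U : GaugeConfig 4 L G) : ℝ :=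
  plaquetteObs r.ρ x i j (torusLift L U)

/-- The curvature species (Wilson action density, six plaquettes) at the `ℤ⁴`-site `x` on the
torus of side `L`, with EXACTLY the translation convention of `smearedLatticeField`. -/
def torusDensity (r : LatticeRep G) (L : ℕ) (x : Zd4) (U : GaugeConfig 4 L G) : ℝ :=
  r.curvature.F (configShift (-x) (torusLift L U))

/-- **Influence profile** (real-valued) `I_p^{(ij)}(β, S, R; x) :=
‖ E_{β,S}[ p_{ij}(x) − ⟨p_{ij}(x)⟩ | exterior of Q_R(x) ] ‖_{Lᵖ(μ_{β,S})}` on the symmetric torus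
of side `2S+1` — ONE plaquette, ONE cube, based at the `ℤ⁴`-site `x` (lead's reshape 2: the base
site is a parameter, so that no stub and no glue needs the translation invariance of the torus
state — the closure consumes only the site-free right-hand side of `GaussianDomination`). -/
def influence (r : LatticeRep G) (β : ℝ) (S R : ℕ) (x : Zd4) (i j : Fin 4) (p : ℝ≥0∞) : ℝ :=
  let μ := wilsonMeasure (d := 4) (L := 2 * S + 1) r.ρ β
  let X : GaugeConfig 4 (2 * S + 1) G → ℝ :=
    fun U => torusPlaquette r (2 * S + 1) i j x U - ∫ V, torusPlaquette r (2 * S + 1) i j x V ∂μ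
  (eLpNorm (μ[X | exterior (2 * S + 1) R x]) p μ).toReal

/-- **Reference RP square** `A(β, S, R) := ⟨θX · X⟩_{β,S}`, `X = p₀₁(R e₀) − ⟨p₀₁⟩`,
`θ = GaugeConfig.timeReflect` (`t ↦ 1 − t`): the reflection-positivity square of ONE plaquette at
height `R` above the reflection hyperplane (reflected separation `2R − 1`); `= ‖E[X | lower
half]‖₂²` in infinite volume (the half-space anchor of the card). -/
def rpSquare (r : LatticeRep G) (β : ℝ) (S R : ℕ) : ℝ :=
  let μ := wilsonMeasure (d := 4) (L := 2 * S + 1) r.ρ β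
  let X : GaugeConfig 4 (2 * S + 1) G → ℝ :=
    fun U => torusPlaquette r (2 * S + 1) 0 1 (Pi.single 0 (R : ℤ)) U -
      ∫ V, torusPlaquette r (2 * S + 1) 0 1 (Pi.single 0 (R : ℤ)) V ∂μ
  ∫ U, X (GaugeConfig.timeReflect U) * X U ∂μ

/-- Reflected-pair two-point function of the ACTION DENSITY: `Cov(P_x ∘ θ, P_y)` on the torus of
side `2S+1` (the summand of the lattice RP square of a smeared curvature field; `P ∘ θ` is the
action density with its temporal plaquettes hanging downward from `θx`). -/
def reflPair (r : LatticeRep G) (β : ℝ) (S : ℕ) (x y : Zd4) : ℝ :=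
  let μ := wilsonMeasure (d := 4) (L := 2 * S + 1) r.ρ β
  (∫ U, torusDensity r (2 * S + 1) x (GaugeConfig.timeReflect U) * torusDensity r (2 * S + 1) y U ∂μ) -
    (∫ U, torusDensity r (2 * S + 1) x (GaugeConfig.timeReflect U) ∂μ) *
      ∫ U, torusDensity r (2 * S + 1) y U ∂μ

/-- Smeared connected three-point function of the centred action density at lattice spacing `a`
(Riemann normalisation `a¹² = (a⁴)³`, no multiplicative renormalisation): the `κ₃` the closure
renormalises by `c_k³`. -/
def smearedThreePoint (r : LatticeRep G) (β : ℝ) (S : ℕ) (a : ℝ) (φ₁ φ₂ φ₃ : 𝓢(E4, ℝ)) : ℝ :=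
  let μ := wilsonMeasure (d := 4) (L := 2 * S + 1) r.ρ β
  let δP : Zd4 → GaugeConfig 4 (2 * S + 1) G → ℝ :=
    fun x U => torusDensity r (2 * S + 1) x U - ∫ V, torusDensity r (2 * S + 1) x V ∂μ
  a ^ 12 * ∑ x ∈ Literature.Probability.LatticeModels.box 4 S,
    ∑ y ∈ Literature.Probability.LatticeModels.box 4 S,
      ∑ z ∈ Literature.Probability.LatticeModels.box 4 S,
        φ₁ (a • siteToE x) * φ₂ (a • siteToE y) * φ₃ (a • siteToE z) *
          ∫ U, δP x U * δP y U * δP z U ∂μ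

end Objects

/-! ## 1. (T)+(M) Telescoping bound and exact antitonicity — provable now -/

/-- **(T) Wilson-torus telescoping bound.** For plaquettes of orientations `o k` at `ℤ⁴` base
points `x k` pairwise more than `2R+1` apart in `ℓ^∞` (and at most `S`, no torus aliasing:
`4R+4 < 2S+1`), the torus `n`-point function of the centred plaquettes is bounded by the product
of the `Lⁿ` influence norms: tower property + pull-out (`condExp_mul_of_stronglyMeasurable_left`,
shell-measurability of the conditional mean as an a.e.-EQUAL version — triage r1-2 note 2) +
DLR/Markov property of the torus Wilson specification (`isSpecification_ymSpecification_t2`) +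
generalised Hölder (no translation invariance needed: the influences are taken at the base
points `x k`). -/
def TelescopingBound : Prop :=
  ∀ (G : Type) [Group G] [TopologicalSpace G] [IsTopologicalGroup G] [CompactSpace G]
    [MeasurableSpace G] [BorelSpace G] (r : LatticeRep G) (β : ℝ) (S R n : ℕ)
    (o : Fin n → Fin 4 × Fin 4) (x : Fin n → Zd4),
    (∀ k, (o k).1 ≠ (o k).2) →
    4 * R + 4 < 2 * S + 1 →
    (∀ k l, k ≠ l → ∃ μ : Fin 4, (2 * R + 1 : ℤ) < |x k μ - x l μ| ∧ |x k μ - x l μ| ≤ S) →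
      let μ := wilsonMeasure (d := 4) (L := 2 * S + 1) r.ρ β
      |∫ U, ∏ k, (torusPlaquette r (2 * S + 1) (o k).1 (o k).2 (x k) U -
          ∫ V, torusPlaquette r (2 * S + 1) (o k).1 (o k).2 (x k) V ∂μ) ∂μ|
        ≤ ∏ k, influence r β S R (x k) (o k).1 (o k).2 n

/-- **(M) Exact antitonicity of the influence profile in the cube radius** (`1 ≤ p`):
`Q_{R'} ⊆ Q_R ⇒ exterior(R) ≤ exterior(R')`, tower property and `Lᵖ`-contractivity of conditional
expectation (`eLpNorm_condExp_le_eLpNorm`); finiteness from boundedness of the plaquette. -/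
def InfluenceAntitone : Prop :=
  ∀ (G : Type) [Group G] [TopologicalSpace G] [IsTopologicalGroup G] [CompactSpace G]
    [MeasurableSpace G] [BorelSpace G] (r : LatticeRep G) (β : ℝ) (S : ℕ) (x : Zd4) (i j : Fin 4)
    (p : ℝ≥0∞), 1 ≤ p → ∀ R R' : ℕ, R' ≤ R → 2 * R + 2 < 2 * S + 1 →
      influence r β S R x i j p ≤ influence r β S R' x i j p

/-! ## 2. (L′) The imported IR input: one-scale lattice gap with `ξ → ∞` -/

/-- **Gap data** for `(G, r)`: a rate function `m` on `[β₁, ∞)` with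
(i) `0 < m(β)`, `m(β) → 0` (`ξ → ∞`);
(ii) 8901-shape ALL-PAIRS volume-uniform decay of connected time-correlations at rate `m(β)`
(per-pair constants; feeds `HasLatticeMassGap` verbatim with `a_k := m(β_k)`, `Δ = 1`);
(iii) RP-SPECTRAL relative clustering of centred slab functionals with thermal error `ε(S) → 0`
(what a transfer-matrix gap `spec T ⊆ {1} ∪ [0, e^{-m}]` gives on large tori; scale-free, so it
survives multiplicative renormalisation — feeds `HasMassGap`/E4 of the continuum limit);
(iv) axial comparability: beyond `c₂/m(β)` (and below a quarter of the torus, where thermal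
images are negligible) the reference RP square decays per unit height by at most `e^{-C₁ m(β)}`
(pins admissible `m` to the plaquette's own mass, `m_P ≤ C₁ m`). -/
def GapData (G : Type) [Group G] [TopologicalSpace G] [IsTopologicalGroup G] [CompactSpace G]
    [MeasurableSpace G] [BorelSpace G] (r : LatticeRep G) (β₁ C₁ c₂ : ℝ) (m : ℝ → ℝ) : Prop :=
  (∀ β : ℝ, β₁ ≤ β → 0 < m β) ∧ Tendsto m atTop (𝓝 0) ∧
  (∀ A B : YMSpecies G, ∃ (C : ℝ) (S₀ : ℕ), ∀ β : ℝ, β₁ ≤ β → ∀ S : ℕ, S₀ ≤ S → ∀ n : ℕ, n ≤ S →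
      |latticeConnectedCorr r.ρ β (2 * S + 1) A.F B.F n| ≤ C * Real.exp (-(m β * n))) ∧
  (∀ β : ℝ, β₁ ≤ β → ∃ ε : ℕ → ℝ, Tendsto ε atTop (𝓝 0) ∧
      ∀ (S T n : ℕ), 2 * (T + n + 1) ≤ S →
        ∀ (Y : LGConfig 4 G → ℝ) (B : ℝ), Measurable Y → (∀ U, |Y U| ≤ B) →
          DependsOn Y {e : ZdEdge4 | 1 ≤ e.1 0 ∧ e.1 0 + (if e.2 = 0 then 1 else 0) ≤ T} →
            let μ := wilsonMeasure (d := 4) (L := 2 * S + 1) r.ρ β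
            |(∫ U, Y (torusLift (2 * S + 1) (GaugeConfig.timeReflect U)) *
                  Y (configShift (-Pi.single 0 (n : ℤ)) (torusLift (2 * S + 1) U)) ∂μ) -
                (∫ U, Y (torusLift (2 * S + 1) U) ∂μ) ^ 2|
              ≤ Real.exp (-(m β * n)) *
                  ((∫ U, Y (torusLift (2 * S + 1) (GaugeConfig.timeReflect U)) *
                      Y (torusLift (2 * S + 1) U) ∂μ) -
                    (∫ U, Y (torusLift (2 * S + 1) U) ∂μ) ^ 2) +
                ε S * B ^ 2) ∧
  (∀ β : ℝ, β₁ ≤ β → ∃ S₀ : ℕ, ∀ S : ℕ, S₀ ≤ S → ∀ n : ℕ, c₂ / m β ≤ n → 4 * n + 8 ≤ S →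
      Real.exp (-(C₁ * m β)) * rpSquare r β S n ≤ rpSquare r β S (n + 1))

/-- **(L′) Lattice gap input** (imported IR open problem, shared with
`ModularSelfDualFold.WeakCouplingLatticeGap` 8901 / `XiCompleteMonotonicity.XiDiverges` 8941):
every compact simple `G` has a faithful `r` and gap data. -/
def LatticeGapInput : Prop :=
  ∀ (G : Type) [Group G] [TopologicalSpace G] [IsTopologicalGroup G] [CompactSpace G]
    [MeasurableSpace G] [BorelSpace G], IsCompactSimpleLieGroup G →
    ∃ (r : LatticeRep G) (β₁ C₁ c₂ : ℝ) (m : ℝ → ℝ), GapData G r β₁ C₁ c₂ m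

/-! ## 3. The window cruxes (ONE plaquette, below every fixed fraction of the correlation length) -/

/-- **(WI₂) Corner-free influence** (the `n = 2` content, kit-checkable two-level estimator):
below `c₀/m(β)` the `L²` influence of the EXTERIOR OF A CUBE of radius `R` on a plaquette at its
centre is at most `C(c₀)` times the square root of the reference RP square at height `R` (the
exact `L²` influence of ONE half-space at that distance): the 8 faces cost a constant.  Stated at
every base site `x` with site-independent constants (reshape 2; equivalent to the origin version
by translation invariance of the torus state, which thereby disappears from the line). -/
def CornerFreeInfluence : Prop :=
  ∀ (G : Type) [Group G] [TopologicalSpace G] [IsTopologicalGroup G] [CompactSpace G]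
    [MeasurableSpace G] [BorelSpace G], IsCompactSimpleLieGroup G →
    ∀ (r : LatticeRep G) (β₁ C₁ c₂ : ℝ) (m : ℝ → ℝ), GapData G r β₁ C₁ c₂ m →
      ∀ c₀ : ℝ, 0 < c₀ → ∃ (C β₀ : ℝ), ∀ β : ℝ, β₀ ≤ β → ∃ S₀ : ℕ, ∀ S : ℕ, S₀ ≤ S →
        ∀ R : ℕ, 1 ≤ R → (R : ℝ) ≤ c₀ / m β → ∀ (x : Zd4) (i j : Fin 4), i ≠ j →
          influence r β S R x i j 2 ≤ C * Real.sqrt (rpSquare r β S R)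

/-- **(WIₙ) Influence reverse Hölder / hypercontractivity** (rank 2 of the line, the bet): below
`c₀/m(β)` the `Lⁿ` influence is at most `C(c₀) n^γ` times the `L²` influence, for EVERY `n ≥ 2`,
uniformly in `β` and in the volume (`γ` explicit and polynomial; an `L^∞` version is FALSE —
large-field shells, triage r1-2).  Spectrally a bound on excited-state form factors of the plaquette
by vacuum overlaps; Gaussian value `γ = 1` (order-2 chaos).  Every base site `x`,
site-independent constants (reshape 2). -/
def InfluenceReverseHolder : Prop :=
  ∀ (G : Type) [Group G] [TopologicalSpace G] [IsTopologicalGroup G] [CompactSpace G]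
    [MeasurableSpace G] [BorelSpace G], IsCompactSimpleLieGroup G →
    ∀ (r : LatticeRep G) (β₁ C₁ c₂ : ℝ) (m : ℝ → ℝ), GapData G r β₁ C₁ c₂ m →
      ∀ c₀ : ℝ, 0 < c₀ → ∃ (C β₀ : ℝ) (γ : ℕ), ∀ β : ℝ, β₀ ≤ β → ∀ n : ℕ, 2 ≤ n →
        ∃ S₀ : ℕ, ∀ S : ℕ, S₀ ≤ S → ∀ R : ℕ, 1 ≤ R → (R : ℝ) ≤ c₀ / m β →
          ∀ (x : Zd4) (i j : Fin 4), i ≠ j →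
            influence r β S R x i j n ≤ C * (n : ℝ) ^ γ * influence r β S R x i j 2

/-- **(W2) Window regularity of the reference RP square** (rank 3 of the line):
(a) bounded effective exponent — polynomial doubling `A(R) ≤ C (R'/R)^p A(R')` for
`1 ≤ R ≤ R' ≤ c₀/m(β)` (no exponential regime between the lattice scale and the gap);
(b) reflected-pair cone comparability — for sites `x, y` at heights in `[R, (1+θ)R]` and transverse
offset `≤ θR`, `Cov(P_x ∘ θ, P_y) ≥ c · A(R)` for the ACTION DENSITY `P` (turns the axial anchor into
a smeared reflection-positive normalisation, making `IsNontrivial` automatic);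
(c) polynomial floor `A(β, S, 1) ≥ m(β)^q` (the renormalisation constant is polynomial in `1/a_k`). -/
def WindowRegularity : Prop :=
  ∀ (G : Type) [Group G] [TopologicalSpace G] [IsTopologicalGroup G] [CompactSpace G]
    [MeasurableSpace G] [BorelSpace G], IsCompactSimpleLieGroup G →
    ∀ (r : LatticeRep G) (β₁ C₁ c₂ : ℝ) (m : ℝ → ℝ), GapData G r β₁ C₁ c₂ m →
      ∀ c₀ : ℝ, 0 < c₀ → ∃ (C c θ β₀ : ℝ) (p q : ℕ), 0 < c ∧ 0 < θ ∧
        ∀ β : ℝ, β₀ ≤ β → ∃ S₀ : ℕ, ∀ S : ℕ, S₀ ≤ S →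
          (∀ R R' : ℕ, 1 ≤ R → R ≤ R' → (R' : ℝ) ≤ c₀ / m β →
              rpSquare r β S R ≤ C * ((R' : ℝ) / R) ^ p * rpSquare r β S R') ∧
          (∀ (R : ℕ) (x y : Zd4), 1 ≤ R → (R : ℝ) ≤ c₀ / m β →
              (R : ℝ) ≤ x 0 → (x 0 : ℝ) ≤ (1 + θ) * R → (R : ℝ) ≤ y 0 → (y 0 : ℝ) ≤ (1 + θ) * R →
              (∀ i : Fin 4, i ≠ 0 → (|x i - y i| : ℝ) ≤ θ * R) →
                c * rpSquare r β S R ≤ reflPair r β S x y) ∧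
          m β ^ q ≤ rpSquare r β S 1

/-! ## 4. (NG) The non-Gaussianity socket -/

/-- **(NG) Scale-free smeared `κ₃` floor** (socket; suppliers: `running-pole-skewness` via the
`β`-derivative identity at scale `ξ`, or an NLO window witness): at SOME physical scale `s₁`, for
three fixed Schwartz bumps with pairwise disjoint supports in the ball of radius `s₁`, the smeared
connected three-point function of the action density at lattice spacing `m(β)` has a definite
sign and is at least `c₁ A(⌊s₁/m(β)⌋)^{3/2}` in size, for `β ≥ β₀` on large tori. -/
def NonGaussianFloor : Prop :=
  ∀ (G : Type) [Group G] [TopologicalSpace G] [IsTopologicalGroup G] [CompactSpace G]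
    [MeasurableSpace G] [BorelSpace G], IsCompactSimpleLieGroup G →
    ∀ (r : LatticeRep G) (β₁ C₁ c₂ : ℝ) (m : ℝ → ℝ), GapData G r β₁ C₁ c₂ m →
      ∃ (s₁ σ c₁ β₀ : ℝ) (φ₁ φ₂ φ₃ : 𝓢(E4, ℝ)), 0 < s₁ ∧ (σ = 1 ∨ σ = -1) ∧ 0 < c₁ ∧
        tsupport φ₁ ⊆ Metric.ball 0 s₁ ∧ tsupport φ₂ ⊆ Metric.ball 0 s₁ ∧
        tsupport φ₃ ⊆ Metric.ball 0 s₁ ∧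
        Disjoint (tsupport φ₁) (tsupport φ₂) ∧ Disjoint (tsupport φ₁) (tsupport φ₃) ∧
        Disjoint (tsupport φ₂) (tsupport φ₃) ∧
        ∀ β : ℝ, β₀ ≤ β → ∃ S₀ : ℕ, ∀ S : ℕ, S₀ ≤ S →
          c₁ * Real.sqrt (rpSquare r β S ⌊s₁ / m β⌋₊) ^ 3 ≤
            σ * smearedThreePoint r β S (m β) φ₁ φ₂ φ₃

/-! ## 5. Gaussian domination of separated moments (derived; the glue is proved below) -/

/-- **Gaussian domination of separated moments** (consequence of (T), (M), (WI₂), (WIₙ)): for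
plaquettes pairwise more than `2R+1` apart and ANY window radius `1 ≤ R' ≤ min(R, c₀/m(β))`, the
torus `n`-point function of the centred plaquettes is at most `(C n^γ √A(R'))ⁿ` — the separated
`n`-point function is dominated by the `(n/2)`-th power of a TWO-point quantity. -/
def GaussianDomination : Prop :=
  ∀ (G : Type) [Group G] [TopologicalSpace G] [IsTopologicalGroup G] [CompactSpace G]
    [MeasurableSpace G] [BorelSpace G], IsCompactSimpleLieGroup G →
    ∀ (r : LatticeRep G) (β₁ C₁ c₂ : ℝ) (m : ℝ → ℝ), GapData G r β₁ C₁ c₂ m →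
      ∀ c₀ : ℝ, 0 < c₀ → ∃ (C β₀ : ℝ) (γ : ℕ), ∀ β : ℝ, β₀ ≤ β → ∀ n : ℕ, 2 ≤ n →
        ∃ S₀ : ℕ, ∀ S : ℕ, S₀ ≤ S →
          ∀ (R R' : ℕ) (o : Fin n → Fin 4 × Fin 4) (x : Fin n → Zd4),
            (∀ k, (o k).1 ≠ (o k).2) → 1 ≤ R' → R' ≤ R → (R' : ℝ) ≤ c₀ / m β →
            4 * R + 4 < 2 * S + 1 →
            (∀ k l, k ≠ l → ∃ μ : Fin 4, (2 * R + 1 : ℤ) < |x k μ - x l μ| ∧ |x k μ - x l μ| ≤ S) →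
              let μ := wilsonMeasure (d := 4) (L := 2 * S + 1) r.ρ β
              |∫ U, ∏ k, (torusPlaquette r (2 * S + 1) (o k).1 (o k).2 (x k) U -
                  ∫ V, torusPlaquette r (2 * S + 1) (o k).1 (o k).2 (x k) V ∂μ) ∂μ|
                ≤ (C * (n : ℝ) ^ γ * Real.sqrt (rpSquare r β S R')) ^ n

/-- The influence profile is non-negative (it is a real `Lᵖ` norm). -/
theorem influence_nonneg {G : Type} [Group G] [TopologicalSpace G] [IsTopologicalGroup G]
    [CompactSpace G] [MeasurableSpace G] [BorelSpace G] (r : LatticeRep G) (β : ℝ) (S R : ℕ)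
    (x : Zd4) (i j : Fin 4) (p : ℝ≥0∞) : 0 ≤ influence r β S R x i j p :=
  ENNReal.toReal_nonneg


/-! ## 6. The one-field form of the crux and its (vendored, checked) reduction to the crux -/

section OneField

variable {G : Type} [Group G] [TopologicalSpace G] [IsTopologicalGroup G] [CompactSpace G]
  [MeasurableSpace G] [BorelSpace G]

/-- **The one-field clauses** for one gauge group and one witness `(r, sch, S₁)`: ONE scalar
field (the curvature) with E0 (normalisation, hermiticity), E0′, E2, E3, E4, translation and
proper-hypercubic invariance on `⁰𝒮`; convergence of the renormalised curvature `n`-point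
functions along `sch`; non-triviality; non-Gaussianity; a continuum gap and the uniform lattice
gap (verbatim the clauses of `HypercubicLimit` restricted to the constant label string —
`Disproof.lean` §4 `Clauses₁`; verbatim the right-hand side of the landed
`Negative.OneFieldReduction.hypercubicLimit_iff_oneField`). -/
def OneFieldWitness (r : LatticeRep G) (sch : SpeciesScheme (YMSpecies G))
    (S₁ : SchwingerFamily E4) : Prop :=
  (S₁.toLabelled.IsNormalized ∧ S₁.toLabelled.IsHermitian ∧ S₁.toLabelled.HasLinearGrowth ∧
    S₁.toLabelled.IsReflectionPositive ∧ S₁.toLabelled.IsSymmetric ∧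
    S₁.toLabelled.HasClusterProperty ∧
    (∀ (n : ℕ) (k : Fin n → Unit) (a : E4) (F : 𝓢((Fin n → E4), ℂ)), IsOffDiagonal F →
      S₁.toLabelled n k (translateMulti a F) = S₁.toLabelled n k F) ∧
    (∀ (n : ℕ) (k : Fin n → Unit) (R : E4 ≃ₗᵢ[ℝ] E4),
      LinearMap.det (R.toLinearEquiv : E4 →ₗ[ℝ] E4) = 1 →
      (∀ i : Fin 4, ∃ j : Fin 4, R (EuclideanSpace.single i 1) = EuclideanSpace.single j 1 ∨
        R (EuclideanSpace.single i 1) = -EuclideanSpace.single j 1) →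
      ∀ F : 𝓢((Fin n → E4), ℂ), IsOffDiagonal F →
        S₁.toLabelled n k (linActMulti R F) = S₁.toLabelled n k F)) ∧
  (∀ (n : ℕ), n ≠ 0 → ∀ (f : Fin n → 𝓢(E4, ℝ)) (F : 𝓢((Fin n → E4), ℂ)),
    IsTensorOf F (fun i => ofRealTest (f i)) → IsOffDiagonal F →
      Tendsto (fun k : ℕ =>
        ((latticeSchwinger r.ρ sch (fun s => s.F) k n (fun _ => r.curvature) f : ℝ) : ℂ))
        atTop (𝓝 (S₁ n F))) ∧
  (∃ (F₁ G₁ : 𝓢((Fin 1 → E4), ℂ)) (H₁ : 𝓢((Fin (1 + 1) → E4), ℂ)),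
    IsTimeOrdered F₁ ∧ IsTimeOrdered G₁ ∧ IsAppendTensorOf H₁ (osAdjoint F₁) G₁ ∧
      S₁ (1 + 1) H₁ ≠ S₁ 1 (osAdjoint F₁) * S₁ 1 G₁) ∧
  (∃ (f g h : 𝓢(E4, ℂ)) (Ffgh : 𝓢((Fin 3 → E4), ℂ)) (Fgh Ffh Ffg : 𝓢((Fin 2 → E4), ℂ))
      (Ff Fg Fh : 𝓢((Fin 1 → E4), ℂ)),
    IsTensorOf Ffgh ![f, g, h] ∧ IsOffDiagonal Ffgh ∧ IsTensorOf Fgh ![g, h] ∧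
    IsTensorOf Ffh ![f, h] ∧ IsTensorOf Ffg ![f, g] ∧ IsTensorOf Ff ![f] ∧ IsTensorOf Fg ![g] ∧
    IsTensorOf Fh ![h] ∧
      S₁ 3 Ffgh - S₁ 1 Ff * S₁ 2 Fgh - S₁ 1 Fg * S₁ 2 Ffh - S₁ 1 Fh * S₁ 2 Ffg +
        2 * (S₁ 1 Ff * S₁ 1 Fg * S₁ 1 Fh) ≠ 0) ∧
  (∃ Δ : ℝ, 0 < Δ ∧ S₁.toLabelled.HasMassGap Δ ∧ HasLatticeMassGap r sch Δ)

end OneField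

/-- **The one-field form of the crux** (`Negative/OneFieldReduction.lean`:
`hypercubicLimit_iff_oneField` says `HypercubicLimit ↔` this, clause by clause): every compact
simple Lie group admits `(r, sch, S₁)` with `OneFieldWitness r sch S₁`. -/
def OneFieldLimit : Prop :=
  ∀ (G : Type) [Group G] [TopologicalSpace G] [IsTopologicalGroup G] [CompactSpace G],
    IsCompactSimpleLieGroup G →
      letI : MeasurableSpace G := borel G
      haveI : BorelSpace G := ⟨rfl⟩
      ∃ (r : LatticeRep G) (sch : SpeciesScheme (YMSpecies G)) (S₁ : SchwingerFamily E4),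
        OneFieldWitness r sch S₁


/-- **Locality of the conditional mean (Markov property of the torus Wilson state)** — the
`Prop` behind the registered stub `stub_condMeanLocality` (reshape 2, lead): for every cube
radius `R` and base site `x`, the conditional expectation of the centred plaquette at `x` given
the links NOT interior to `Q_R(x)` has a version measurable with respect to the links interior to
`Q_{R+1}(x)` (interior ∪ shell).  Route: the torus Wilson state is the full-volume Gibbs
distribution of the plaquette potential on the finite link set (tree `gibbsSpecOfPotential`,
`isSpecification_gibbsSpecOfPotential`), hence a DLR state, so the specification kernel is a
version of the conditional expectation (`IsGibbsMeasure.integral_ae_eq_condExp`), and the kernel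
reads only links of plaquettes touching `Q_R(x)`, all inside `Q_{R+1}(x)` (no side condition on
`R` versus `S` is needed: everything is stated through images under `torusEdge`). -/
def CondMeanLocality : Prop :=
  ∀ (G : Type) [Group G] [TopologicalSpace G] [IsTopologicalGroup G] [CompactSpace G]
        [MeasurableSpace G] [BorelSpace G] (r : LatticeRep G) (β : ℝ) (S R : ℕ)
        (x : Literature.Probability.LatticeModels.Site 4) (i j : Fin 4),
      ∃ g : GaugeConfig 4 (2 * S + 1) G → ℝ,
        StronglyMeasurable[(cylinderEvents
            (torusEdge (2 * S + 1) ''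
              {e : Literature.MathematicalPhysics.QuantumLattice.ZdEdge 4 |
                (∀ ν, |e.1 ν - x ν| ≤ ((R + 1 : ℕ) : ℤ)) ∧
                ∀ ν, |e.1 ν + (if ν = e.2 then 1 else 0) - x ν| ≤ ((R + 1 : ℕ) : ℤ)}) :
            MeasurableSpace (GaugeConfig 4 (2 * S + 1) G))] g ∧
        g =ᵐ[(wilsonMeasure r.ρ β : Measure (GaugeConfig 4 (2 * S + 1) G))]
          (wilsonMeasure r.ρ β : Measure (GaugeConfig 4 (2 * S + 1) G))[fun U =>
              plaquetteObs r.ρ x i j (torusLift (2 * S + 1) U) -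
                ∫ V, plaquetteObs r.ρ x i j (torusLift (2 * S + 1) V)
                  ∂(wilsonMeasure r.ρ β : Measure (GaugeConfig 4 (2 * S + 1) G)) |
            (cylinderEvents
              (torusEdge (2 * S + 1) ''
                {e : Literature.MathematicalPhysics.QuantumLattice.ZdEdge 4 |
                  (∀ ν, |e.1 ν - x ν| ≤ R) ∧
                  ∀ ν, |e.1 ν + (if ν = e.2 then 1 else 0) - x ν| ≤ R})ᶜ :
              MeasurableSpace (GaugeConfig 4 (2 * S + 1) G))]




/-! ## drefute-2 §A.  Junk-group port (reshape 2, base site `x`): every window inequality is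
RELATIVE and holds at `G = PUnit`; `GapData` is junk-inhabited; W2(c) is the only `G ≠ 1` clause.
(Gen-1 lemmas of `DRefuteLoadBearingPUnit.lean`, re-checked against the x-carrying signatures.) -/

section PUnitModel

open Summit.QuantumFields.YangMills.Theorems.HypercubicLimit.Negative (punitRep)

/-- On a one-point probability space every integral is evaluation. -/
theorem integral_eq_apply_default {Ω : Type*} [MeasurableSpace Ω] [Unique Ω] (μ : Measure Ω)
    [IsProbabilityMeasure μ] (f : Ω → ℝ) : ∫ x, f x ∂μ = f default := by
  have hf : f = fun _ => f default := funext fun x => congrArg f (Subsingleton.elim x default)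
  rw [hf, integral_const]
  simp

/-- All `ℤ⁴`-configurations with values in `PUnit` coincide. -/
theorem lgConfig_punit_eq (U V : LGConfig 4 PUnit) : U = V := Subsingleton.elim U V

variable (r : LatticeRep PUnit)

instance isProbabilityMeasure_wilsonMeasure_punit (L : ℕ) [NeZero L] (β : ℝ) :
    IsProbabilityMeasure (wilsonMeasure (d := 4) (L := L) r.ρ β) :=
  isProbabilityMeasure_wilsonMeasure (d := 4) (L := L) r.ρ r.continuous β

/-- The centred torus plaquette vanishes identically for `G = PUnit`. -/
theorem centred_torusPlaquette_punit (L : ℕ) [NeZero L] (β : ℝ) (i j : Fin 4) (x : Zd4) :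
    (fun U : GaugeConfig 4 L PUnit => torusPlaquette r L i j x U -
        ∫ V, torusPlaquette r L i j x V ∂(wilsonMeasure (d := 4) (L := L) r.ρ β)) = 0 := by
  funext U
  rw [integral_eq_apply_default, Pi.zero_apply, Subsingleton.elim U default, sub_self]

/-- Pointwise form. -/
theorem centred_torusPlaquette_punit_apply (L : ℕ) [NeZero L] (β : ℝ) (i j : Fin 4) (x : Zd4)
    (U : GaugeConfig 4 L PUnit) :
    torusPlaquette r L i j x U -
        ∫ V, torusPlaquette r L i j x V ∂(wilsonMeasure (d := 4) (L := L) r.ρ β) = 0 := by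
  rw [integral_eq_apply_default, Subsingleton.elim U default, sub_self]

/-- The centred torus action density vanishes identically for `G = PUnit`. -/
theorem centred_torusDensity_punit (L : ℕ) [NeZero L] (β : ℝ) (x : Zd4) (U : GaugeConfig 4 L PUnit) :
    torusDensity r L x U - ∫ V, torusDensity r L x V ∂(wilsonMeasure (d := 4) (L := L) r.ρ β) = 0 := by
  rw [integral_eq_apply_default, Subsingleton.elim U default, sub_self]

/-- `influence ≡ 0` at `G = PUnit` (every exponent, radius, volume, coupling, BASE SITE). -/
theorem influence_punit (β : ℝ) (S R : ℕ) (x : Zd4) (i j : Fin 4) (p : ℝ≥0∞) :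
    influence r β S R x i j p = 0 := by
  dsimp only [influence]
  rw [centred_torusPlaquette_punit, condExp_zero, eLpNorm_zero, ENNReal.toReal_zero]

/-- `rpSquare ≡ 0` at `G = PUnit`. -/
theorem rpSquare_punit (β : ℝ) (S R : ℕ) : rpSquare r β S R = 0 := by
  dsimp only [rpSquare]
  simp only [centred_torusPlaquette_punit_apply, mul_zero, integral_zero]

/-- `reflPair ≡ 0` at `G = PUnit`. -/
theorem reflPair_punit (β : ℝ) (S : ℕ) (x y : Zd4) : reflPair r β S x y = 0 := by
  dsimp only [reflPair]
  rw [integral_eq_apply_default, integral_eq_apply_default, integral_eq_apply_default]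
  have h1 : torusDensity r (2 * S + 1) x (GaugeConfig.timeReflect (default : GaugeConfig 4 (2 * S + 1) PUnit))
      = torusDensity r (2 * S + 1) x default :=
    congrArg _ (Subsingleton.elim _ _)
  rw [h1]; ring

/-- `latticeConnectedCorr ≡ 0` at `G = PUnit`. -/
theorem latticeConnectedCorr_punit (β : ℝ) (L : ℕ) [NeZero L] (A B : LGConfig 4 PUnit → ℝ) (n : ℕ) :
    latticeConnectedCorr r.ρ β L A B n = 0 := by
  unfold latticeConnectedCorr
  rw [integral_eq_apply_default, integral_eq_apply_default, integral_eq_apply_default,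
    lgConfig_punit_eq (configShift _ (torusLift L default)) (torusLift L default)]
  ring

/-- The smeared three-point function against the zero test functions vanishes (any group). -/
theorem smearedThreePoint_zero {G : Type} [Group G] [TopologicalSpace G] [IsTopologicalGroup G]
    [CompactSpace G] [MeasurableSpace G] [BorelSpace G] (r' : LatticeRep G) (β : ℝ) (S : ℕ) (a : ℝ) :
    smearedThreePoint r' β S a 0 0 0 = 0 := by
  simp [smearedThreePoint]

/-- **Gap data are inhabited by junk**: at `G = PUnit` every clause of `GapData` holds with the
rate `m(β) = e^{-β}`, for all `β₁ C₁ c₂`. -/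
theorem gapData_punit (β₁ C₁ c₂ : ℝ) : GapData PUnit r β₁ C₁ c₂ (fun β => Real.exp (-β)) := by
  refine ⟨fun β _ => Real.exp_pos _, Real.tendsto_exp_neg_atTop_nhds_zero, ?_, ?_, ?_⟩
  · intro A B
    refine ⟨0, 0, fun β _ S _ n _ => ?_⟩
    rw [latticeConnectedCorr_punit]; simp
  · intro β _
    refine ⟨fun _ => 0, tendsto_const_nhds, fun S T n _ Y B _ _ _ => ?_⟩
    dsimp only
    rw [integral_eq_apply_default, integral_eq_apply_default, integral_eq_apply_default,
      lgConfig_punit_eq (torusLift (2 * S + 1) (GaugeConfig.timeReflect default)) (torusLift (2 * S + 1) default),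
      lgConfig_punit_eq (configShift _ (torusLift (2 * S + 1) default)) (torusLift (2 * S + 1) default)]
    have : Y (torusLift (2 * S + 1) default) * Y (torusLift (2 * S + 1) default) -
        Y (torusLift (2 * S + 1) default) ^ 2 = 0 := by ring
    rw [this]; simp
  · intro β _
    refine ⟨0, fun S _ n _ _ => ?_⟩
    rw [rpSquare_punit, rpSquare_punit]; simp

/-- The BODY of `LatticeGapInput` holds at `PUnit`. -/
theorem latticeGapInput_body_punit :
    ∃ (r : LatticeRep PUnit) (β₁ C₁ c₂ : ℝ) (m : ℝ → ℝ), GapData PUnit r β₁ C₁ c₂ m :=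
  ⟨punitRep, 0, 1, 1, _, gapData_punit punitRep 0 1 1⟩

/-- The body of **`CornerFreeInfluence`** (reshape 2: every base site) holds at `G = PUnit`. -/
theorem cornerFreeInfluence_body_punit (m : ℝ → ℝ) (c₀ : ℝ) :
    ∃ (C β₀ : ℝ), ∀ β : ℝ, β₀ ≤ β → ∃ S₀ : ℕ, ∀ S : ℕ, S₀ ≤ S →
      ∀ R : ℕ, 1 ≤ R → (R : ℝ) ≤ c₀ / m β → ∀ (x : Zd4) (i j : Fin 4), i ≠ j →
        influence r β S R x i j 2 ≤ C * Real.sqrt (rpSquare r β S R) :=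
  ⟨0, 0, fun β _ => ⟨0, fun S _ R _ _ x i j _ => by rw [influence_punit, rpSquare_punit]; simp⟩⟩

/-- The body of **`InfluenceReverseHolder`** (reshape 2) holds at `G = PUnit` (`C = 0`, `γ = 0`). -/
theorem influenceReverseHolder_body_punit (m : ℝ → ℝ) (c₀ : ℝ) :
    ∃ (C β₀ : ℝ) (γ : ℕ), ∀ β : ℝ, β₀ ≤ β → ∀ n : ℕ, 2 ≤ n →
      ∃ S₀ : ℕ, ∀ S : ℕ, S₀ ≤ S → ∀ R : ℕ, 1 ≤ R → (R : ℝ) ≤ c₀ / m β →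
        ∀ (x : Zd4) (i j : Fin 4), i ≠ j →
          influence r β S R x i j n ≤ C * (n : ℝ) ^ γ * influence r β S R x i j 2 :=
  ⟨0, 0, 0, fun β _ n _ => ⟨0, fun S _ R _ _ x i j _ => by
    rw [influence_punit, influence_punit]; simp⟩⟩

/-- The body of **`NonGaussianFloor`** holds at `G = PUnit` (zero test functions). -/
theorem nonGaussianFloor_body_punit (m : ℝ → ℝ) :
    ∃ (s₁ σ c₁ β₀ : ℝ) (φ₁ φ₂ φ₃ : 𝓢(E4, ℝ)), 0 < s₁ ∧ (σ = 1 ∨ σ = -1) ∧ 0 < c₁ ∧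
      tsupport φ₁ ⊆ Metric.ball 0 s₁ ∧ tsupport φ₂ ⊆ Metric.ball 0 s₁ ∧
      tsupport φ₃ ⊆ Metric.ball 0 s₁ ∧
      Disjoint (tsupport φ₁) (tsupport φ₂) ∧ Disjoint (tsupport φ₁) (tsupport φ₃) ∧
      Disjoint (tsupport φ₂) (tsupport φ₃) ∧
      ∀ β : ℝ, β₀ ≤ β → ∃ S₀ : ℕ, ∀ S : ℕ, S₀ ≤ S →
        c₁ * Real.sqrt (rpSquare r β S ⌊s₁ / m β⌋₊) ^ 3 ≤
          σ * smearedThreePoint r β S (m β) φ₁ φ₂ φ₃ := by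
  have h0 : tsupport ((0 : 𝓢(E4, ℝ)) : E4 → ℝ) = ∅ := by
    rw [tsupport_eq_empty_iff]; rfl
  refine ⟨1, 1, 1, 0, 0, 0, 0, one_pos, Or.inl rfl, one_pos, ?_, ?_, ?_, ?_, ?_, ?_, ?_⟩
  iterate 3 (rw [h0]; exact Set.empty_subset _)
  iterate 3 (rw [h0]; exact Set.empty_disjoint _  |>.mono_right le_rfl)
  intro β _
  refine ⟨0, fun S _ => ?_⟩
  rw [rpSquare_punit, smearedThreePoint_zero]; simp

/-- Clauses (a) and (b) of **`WindowRegularity`** hold at `G = PUnit`. -/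
theorem windowRegularity_ab_body_punit (β : ℝ) (S : ℕ) (C c : ℝ) (p : ℕ) :
    (∀ R R' : ℕ, rpSquare r β S R ≤ C * ((R' : ℝ) / R) ^ p * rpSquare r β S R') ∧
    (∀ (R : ℕ) (x y : Zd4), c * rpSquare r β S R ≤ reflPair r β S x y) := by
  refine ⟨fun R R' => ?_, fun R x y => ?_⟩
  · rw [rpSquare_punit, rpSquare_punit]; simp
  · rw [rpSquare_punit, reflPair_punit]; simp

/-- Clause (c) of **`WindowRegularity`** FAILS at `G = PUnit` for every positive rate. -/
theorem windowRegularity_c_false_punit (m : ℝ → ℝ) {β : ℝ} (hm : 0 < m β) (S : ℕ) (q : ℕ) :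
    ¬ m β ^ q ≤ rpSquare r β S 1 := by
  rw [rpSquare_punit]; exact not_le.mpr (pow_pos hm q)

/-- `WindowRegularity` with the hypothesis `IsCompactSimpleLieGroup G →` deleted (otherwise
verbatim). -/
def WindowRegularityWithoutSimple : Prop :=
  ∀ (G : Type) [Group G] [TopologicalSpace G] [IsTopologicalGroup G] [CompactSpace G]
    [MeasurableSpace G] [BorelSpace G],
    ∀ (r : LatticeRep G) (β₁ C₁ c₂ : ℝ) (m : ℝ → ℝ), GapData G r β₁ C₁ c₂ m →
      ∀ c₀ : ℝ, 0 < c₀ → ∃ (C c θ β₀ : ℝ) (p q : ℕ), 0 < c ∧ 0 < θ ∧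
        ∀ β : ℝ, β₀ ≤ β → ∃ S₀ : ℕ, ∀ S : ℕ, S₀ ≤ S →
          (∀ R R' : ℕ, 1 ≤ R → R ≤ R' → (R' : ℝ) ≤ c₀ / m β →
              rpSquare r β S R ≤ C * ((R' : ℝ) / R) ^ p * rpSquare r β S R') ∧
          (∀ (R : ℕ) (x y : Zd4), 1 ≤ R → (R : ℝ) ≤ c₀ / m β →
              (R : ℝ) ≤ x 0 → (x 0 : ℝ) ≤ (1 + θ) * R → (R : ℝ) ≤ y 0 → (y 0 : ℝ) ≤ (1 + θ) * R →
              (∀ i : Fin 4, i ≠ 0 → (|x i - y i| : ℝ) ≤ θ * R) →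
                c * rpSquare r β S R ≤ reflPair r β S x y) ∧
          m β ^ q ≤ rpSquare r β S 1

/-- With the simplicity hypothesis restored this IS the line's `WindowRegularity`. -/
theorem windowRegularity_iff_without_add_simple :
    WindowRegularity ↔
      ∀ (G : Type) [Group G] [TopologicalSpace G] [IsTopologicalGroup G] [CompactSpace G]
        [MeasurableSpace G] [BorelSpace G], IsCompactSimpleLieGroup G →
        ∀ (r : LatticeRep G) (β₁ C₁ c₂ : ℝ) (m : ℝ → ℝ), GapData G r β₁ C₁ c₂ m →
          ∀ c₀ : ℝ, 0 < c₀ → ∃ (C c θ β₀ : ℝ) (p q : ℕ), 0 < c ∧ 0 < θ ∧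
            ∀ β : ℝ, β₀ ≤ β → ∃ S₀ : ℕ, ∀ S : ℕ, S₀ ≤ S →
              (∀ R R' : ℕ, 1 ≤ R → R ≤ R' → (R' : ℝ) ≤ c₀ / m β →
                  rpSquare r β S R ≤ C * ((R' : ℝ) / R) ^ p * rpSquare r β S R') ∧
              (∀ (R : ℕ) (x y : Zd4), 1 ≤ R → (R : ℝ) ≤ c₀ / m β →
                  (R : ℝ) ≤ x 0 → (x 0 : ℝ) ≤ (1 + θ) * R → (R : ℝ) ≤ y 0 →
                  (y 0 : ℝ) ≤ (1 + θ) * R → (∀ i : Fin 4, i ≠ 0 → (|x i - y i| : ℝ) ≤ θ * R) →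
                    c * rpSquare r β S R ≤ reflPair r β S x y) ∧
              m β ^ q ≤ rpSquare r β S 1 :=
  Iff.rfl

/-- **`IsCompactSimpleLieGroup` is load-bearing in `stub_windowRegularity`** (clause (c) only):
witness `G = PUnit`, `r = punitRep`, `m(β) = e^{-β}`. -/
theorem not_windowRegularityWithoutSimple : ¬ WindowRegularityWithoutSimple := by
  intro h
  obtain ⟨C, c, θ, β₀, p, q, -, -, h'⟩ :=
    h PUnit punitRep 0 1 1 (fun β => Real.exp (-β)) (gapData_punit punitRep 0 1 1) 1 one_pos
  obtain ⟨S₀, hS⟩ := h' β₀ le_rfl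
  exact windowRegularity_c_false_punit punitRep (fun β => Real.exp (-β)) (Real.exp_pos _) S₀ q
    (hS S₀ le_rfl).2.2

/-- The NEW stub's body **`CondMeanLocality` is `G`-blind**: at `G = PUnit` the centred plaquette
is `0`, its conditional mean is `0`, and `g = 0` is measurable for every σ-algebra (no hypothesis of
the stub to mutate; recorded only to close the junk direction of the reshape-2 stub set). -/
theorem condMeanLocality_body_punit (β : ℝ) (S R : ℕ) (x : Zd4) (i j : Fin 4) :
    ∃ g : GaugeConfig 4 (2 * S + 1) PUnit → ℝ,
      StronglyMeasurable[(cylinderEvents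
          (torusEdge (2 * S + 1) ''
            {e : Literature.MathematicalPhysics.QuantumLattice.ZdEdge 4 |
              (∀ ν, |e.1 ν - x ν| ≤ ((R + 1 : ℕ) : ℤ)) ∧
              ∀ ν, |e.1 ν + (if ν = e.2 then 1 else 0) - x ν| ≤ ((R + 1 : ℕ) : ℤ)}) :
          MeasurableSpace (GaugeConfig 4 (2 * S + 1) PUnit))] g ∧
      g =ᵐ[(wilsonMeasure r.ρ β : Measure (GaugeConfig 4 (2 * S + 1) PUnit))]
        (wilsonMeasure r.ρ β : Measure (GaugeConfig 4 (2 * S + 1) PUnit))[fun U =>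
            plaquetteObs r.ρ x i j (torusLift (2 * S + 1) U) -
              ∫ V, plaquetteObs r.ρ x i j (torusLift (2 * S + 1) V)
                ∂(wilsonMeasure r.ρ β : Measure (GaugeConfig 4 (2 * S + 1) PUnit)) |
          (cylinderEvents
            (torusEdge (2 * S + 1) ''
              {e : Literature.MathematicalPhysics.QuantumLattice.ZdEdge 4 |
                (∀ ν, |e.1 ν - x ν| ≤ R) ∧
                ∀ ν, |e.1 ν + (if ν = e.2 then 1 else 0) - x ν| ≤ R})ᶜ :
            MeasurableSpace (GaugeConfig 4 (2 * S + 1) PUnit))] := by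
  refine ⟨0, stronglyMeasurable_const, ?_⟩
  have h := centred_torusPlaquette_punit r (2 * S + 1) β i j x
  dsimp only [torusPlaquette] at h
  rw [h, condExp_zero]

/-- Hence `CondMeanLocality` restricted to `G = PUnit` holds outright. -/
theorem condMeanLocality_punit :
    ∀ (r : LatticeRep PUnit) (β : ℝ) (S R : ℕ) (x : Zd4) (i j : Fin 4),
      ∃ g : GaugeConfig 4 (2 * S + 1) PUnit → ℝ,
        StronglyMeasurable[(cylinderEvents
            (torusEdge (2 * S + 1) ''
              {e : Literature.MathematicalPhysics.QuantumLattice.ZdEdge 4 |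
                (∀ ν, |e.1 ν - x ν| ≤ ((R + 1 : ℕ) : ℤ)) ∧
                ∀ ν, |e.1 ν + (if ν = e.2 then 1 else 0) - x ν| ≤ ((R + 1 : ℕ) : ℤ)}) :
            MeasurableSpace (GaugeConfig 4 (2 * S + 1) PUnit))] g ∧
        g =ᵐ[(wilsonMeasure r.ρ β : Measure (GaugeConfig 4 (2 * S + 1) PUnit))]
          (wilsonMeasure r.ρ β : Measure (GaugeConfig 4 (2 * S + 1) PUnit))[fun U =>
              plaquetteObs r.ρ x i j (torusLift (2 * S + 1) U) -
                ∫ V, plaquetteObs r.ρ x i j (torusLift (2 * S + 1) V)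
                  ∂(wilsonMeasure r.ρ β : Measure (GaugeConfig 4 (2 * S + 1) PUnit)) |
            (cylinderEvents
              (torusEdge (2 * S + 1) ''
                {e : Literature.MathematicalPhysics.QuantumLattice.ZdEdge 4 |
                  (∀ ν, |e.1 ν - x ν| ≤ R) ∧
                  ∀ ν, |e.1 ν + (if ν = e.2 then 1 else 0) - x ν| ≤ R})ᶜ :
              MeasurableSpace (GaugeConfig 4 (2 * S + 1) PUnit))] :=
  fun r β S R x i j => condMeanLocality_body_punit r β S R x i j

end PUnitModel

/-! ## drefute-2 §B.  Geometry of (T): the typed separation clause does separate the torus images,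
and the fit hypothesis `4R+4 < 2S+1` is redundant.

For the pull-out chain behind `TelescopingBound` the prover needs, for `k ≠ l`, that the links
interior to `Q_{R+1}(x_k)` (where the locality version `g_k` of `stub_condMeanLocality` lives, and
where the plaquette at `x_l` itself lives) and the links interior to `Q_R(x_l)` (the ones
integrated out by the `l`-th conditional expectation) have DISJOINT torus images.  Under exactly the
typed hypothesis `2R+1 < |x_k^μ − x_l^μ| ≤ S` this holds on the torus of side `2S+1`
(`torusEdge_cubeEdges_disjoint`): a collision would give a non-zero integer of modulus
`≤ S + 2R + 1 < 2S + 1` divisible by `2S+1`.  The same clause forces `2R+2 ≤ S`, so (T)'s extra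
hypothesis `4R+4 < 2S+1` is implied whenever `n ≥ 2` (`fit_of_separated`); for `n ≤ 1` (T) is
trivial (`Disproof.lean` §10 `telescoping_n_zero/one`).  Mutation record: dropping `|…| ≤ S` DOES
break (T) for `R ≥ 1` (torus aliasing `x_l = x_k + (2S+1)e_ν`: LHS = Var p, RHS = ‖E[δp|ext]‖₂² < Var p
for any non-trivial `G`) — paper only. -/

section Geometry

open Literature.Probability.LatticeModels

/-- A non-zero integer of modulus `< L` is not divisible by `L`. -/
theorem not_dvd_of_abs_lt {L : ℕ} {z : ℤ} (hz : z ≠ 0) (hlt : |z| < L) : ¬ ((L : ℤ) ∣ z) := by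
  intro hd
  have := Int.le_of_dvd (abs_pos.mpr hz) ((dvd_abs _ _).mpr hd)
  omega

/-- **The typed separation clause separates the torus images** (geometry of (T)): if
`2R+1 < |x μ − y μ| ≤ S` for some coordinate `μ`, then on the torus of side `2S+1` no link interior
to `Q_{R+1}(x)` has the same image as a link interior to `Q_R(y)`. -/
theorem torusEdge_cubeEdges_disjoint (S R : ℕ) (x y : Zd4) (μ : Fin 4)
    (hsep : (2 * R + 1 : ℤ) < |x μ - y μ|) (hS : |x μ - y μ| ≤ S) :
    Disjoint (cubeEdgesT (2 * S + 1) (R + 1) x) (cubeEdgesT (2 * S + 1) R y) := by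
  rw [Set.disjoint_left]
  rintro _ ⟨e, he, rfl⟩ ⟨e', he', hee'⟩
  -- same direction and same base point mod 2S+1
  have h1 : Torus.proj (2 * S + 1) e'.1 = Torus.proj (2 * S + 1) e.1 := congrArg Prod.fst hee'
  have hμ : ((e'.1 μ : ℤ) : ZMod (2 * S + 1)) = ((e.1 μ : ℤ) : ZMod (2 * S + 1)) :=
    congrFun h1 μ
  rw [ZMod.intCast_eq_intCast_iff_dvd_sub] at hμ
  -- bounds from membership in the cubes (first conjuncts suffice)
  have ha : |e.1 μ - x μ| ≤ ((R + 1 : ℕ) : ℤ) := he.1 μ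
  have hb : |e'.1 μ - y μ| ≤ (R : ℤ) := he'.1 μ
  have hne : e.1 μ - e'.1 μ ≠ 0 := by
    intro h0
    have : |x μ - y μ| ≤ 2 * R + 1 := by
      rw [abs_le] at ha hb ⊢; push_cast at ha; omega
    omega
  have hRS : (2 * R + 1 : ℤ) < S := lt_of_lt_of_le hsep hS
  have hlt : |e.1 μ - e'.1 μ| < ((2 * S + 1 : ℕ) : ℤ) := by
    rw [abs_le] at ha hb hS; rw [abs_lt]; push_cast at ha ⊢; omega
  exact not_dvd_of_abs_lt hne hlt hμ

/-- **The fit hypothesis of (T) is redundant for `n ≥ 2`**: two distinct indices and the typed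
separation clause force `2R+2 ≤ S`, hence `4R+4 < 2S+1`. -/
theorem fit_of_separated {n : ℕ} (S R : ℕ) (x : Fin n → Zd4) (hn : 2 ≤ n)
    (hsep : ∀ k l : Fin n, k ≠ l → ∃ μ : Fin 4, (2 * R + 1 : ℤ) < |x k μ - x l μ| ∧ |x k μ - x l μ| ≤ S) :
    4 * R + 4 < 2 * S + 1 := by
  obtain ⟨μ, h1, h2⟩ := hsep ⟨0, by omega⟩ ⟨1, by omega⟩ (by simp [Fin.ext_iff])
  have : (2 * R + 1 : ℤ) < S := lt_of_lt_of_le h1 h2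
  omega

end Geometry

end Summit.QuantumFields.YangMills.Cruxes.HypercubicLimit.DRefute2

end
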